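import Mathlib.Analysis.Fourier.LpSpace
import Mathlib.MeasureTheory.Constructions.Polish.Basic
import Literature.Analysis.FunctionSpaces.LittlewoodPaleyPartitionProofs
import Literature.Analysis.FunctionSpaces.LittlewoodPaleyConvergenceProofs
import HarnessLib

/-!
# The Littlewood–Paley square function on `L²`: `Ḃ⁰_{2,2} = L²`

Analysis/FunctionSpaces support file (serves the discharge of
`Literature.Analysis.FluidPDE.cheskidov_shvydkoy`, ns.S31: Cheskidov–Shvydkoy's frequency-localised
energy method sums the block energies `2^{2qs} ‖u_q‖²_{L²}` and compares them with Sobolev norms,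
which needs the almost-orthogonality of the dyadic blocks in `L²`).

For the homogeneous blocks `Δ̇_j = φ_j(D)` of the accepted `LittlewoodPaley.lean` and `f ∈ L²(E; F)`
(`F` a complex Hilbert space), all **proved** here by Plancherel with Mathlib's `L²` Fourier
isometry (`MeasureTheory.Lp.fourierTransformₗᵢ`, `Lp.fourier_toTemperedDistribution_eq`):

* `fourierMultiplierCLM_coe_eq_coe`, `eLpNormDistrib_fourierMultiplierCLM_coe_sq`: a bounded
  multiplier of temperate growth acts on `L²` as `𝓕⁻¹ (m · 𝓕 f)` and
  `‖m(D) f‖²_{L²} = ∫ |m|² ‖𝓕 f‖²`;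
* `tsum_enorm_dyadicSymbol_sq_le`, `half_le_tsum_enorm_dyadicSymbol_sq`: `1/2 ≤ ∑_j |φ_j(ξ)|² ≤ 8`
  for `ξ ≠ 0` (at most two consecutive symbols are nonzero, `le_add_one_of_dyadicSymbol_ne_zero`,
  each of modulus `≤ 2`, and `∑_j φ_j = 1`, the accepted `sum_dyadicSymbol_holds`; the cutoff is not
  known to be monotone, so `φ_j ≥ 0` is not available and the constants are `1/2, 8` rather than
  `1/2, 1`);
* **the square function theorem** `∑_j ‖Δ̇_j f‖²_{L²} ≤ 8 ‖f‖²_{L²}`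
  (`tsum_eLpNormDistrib_lpBlock_sq_le`) and `‖f‖²_{L²} ≤ 2 ∑_j ‖Δ̇_j f‖²_{L²}`
  (`enorm_sq_le_two_mul_tsum_eLpNormDistrib_lpBlock_sq`), i.e. `Ḃ⁰_{2,2} = L²` with equivalent norms
  (BCD Thm. 2.40 / Prop. 2.x: `Ḃ^s_{2,2} = Ḣ^s`; here `s = 0`);
* `tendsto_eLpNormDistrib_sub_sum_lpBlock`: the symmetric partial sums converge,
  `‖f - ∑_{|j| ≤ n} Δ̇_j f‖_{L²} → 0` (the remainder is the multiplier `remainderSymbol n`, bounded by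
  `3` and tending to `0` off the origin; dominated convergence).

## References

* H. Bahouri, J.-Y. Chemin, R. Danchin, *Fourier Analysis and Nonlinear PDE*, Springer 2011,
  Prop. 2.10, (2.4), §2.3 and the identification `Ḃ^s_{2,2} = Ḣ^s`. [BCD]
* A. Cheskidov, R. Shvydkoy, Arch. Ration. Mech. Anal. 195 (2010), proof of Lemma 3.2 (sums of
  `λ_q^{1+ε} ‖u_q‖²₂` against `H^{s}` norms). [CheskidovShvydkoy2010]
-/

noncomputable section

open MeasureTheory FourierTransform SchwartzMap TemperedDistribution Filter Topology Function
open scoped ENNReal NNReal FourierTransform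

namespace Literature.Analysis.FunctionSpaces

/-! ## The dyadic symbols: size and overlap -/

section Symbol

variable {E : Type*} [NormedAddCommGroup E] [InnerProductSpace ℝ E]

/-- `‖φ_j(ξ)‖ ≤ 2`: the dyadic symbol is a difference of two cut-off values in `[0, 1]`. [folklore] -/
theorem norm_dyadicSymbol_le_two (j : ℤ) (ξ : E) : ‖dyadicSymbol j ξ‖ ≤ 2 := by
  rw [dyadicSymbol_eq_sub, Pi.sub_apply]
  refine (norm_sub_le _ _).trans ?_
  have h1 := norm_lowFreqSymbol_le_one (E := E) j ξ
  have h2 := norm_lowFreqSymbol_le_one (E := E) (j - 1) ξ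
  linarith

/-- `‖φ_j(ξ)‖ₑ² ≤ 4`. [folklore] -/
theorem enorm_dyadicSymbol_sq_le_four (j : ℤ) (ξ : E) : ‖dyadicSymbol j ξ‖ₑ ^ 2 ≤ 4 := by
  have h : ‖dyadicSymbol j ξ‖ₑ ≤ 2 := by
    rw [← ofReal_norm]
    exact (ENNReal.ofReal_le_ofReal (norm_dyadicSymbol_le_two j ξ)).trans_eq (by simp)
  calc ‖dyadicSymbol j ξ‖ₑ ^ 2 ≤ 2 ^ 2 := pow_le_pow_left' h 2
    _ = 4 := by norm_num

/-- **Overlap of the dyadic symbols**: if `φ_j(ξ) ≠ 0` and `φ_{j'}(ξ) ≠ 0` then `j' ≤ j + 1`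
(`2^{j'-1} < ‖ξ‖ < 2^{j+1}`). [folklore] -/
theorem le_add_one_of_dyadicSymbol_ne_zero {j j' : ℤ} {ξ : E} (h : dyadicSymbol j ξ ≠ 0)
    (h' : dyadicSymbol j' ξ ≠ 0) : j' ≤ j + 1 := by
  have h1 : ‖ξ‖ < (2 : ℝ) ^ (j + 1) := by
    by_contra hle
    exact h (dyadicSymbol_apply_of_le_norm_holds (not_lt.1 hle))
  have h2 : (2 : ℝ) ^ (j' - 1) < ‖ξ‖ := by
    by_contra hle
    exact h' (dyadicSymbol_apply_of_norm_le_holds (not_lt.1 hle))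
  have h3 : (2 : ℝ) ^ (j' - 1) < (2 : ℝ) ^ (j + 1) := h2.trans h1
  have h4 : j' - 1 < j + 1 := (zpow_lt_zpow_iff_right₀ one_lt_two).1 h3
  omega

/-- The support of `j ↦ φ_j(ξ)` around a member `j₀`: every member lies in `{j₀ - 1, j₀, j₀ + 1}`.
[folklore] -/
theorem dyadicSymbol_eq_zero_of_not_mem {j₀ j : ℤ} {ξ : E} (hj₀ : dyadicSymbol j₀ ξ ≠ 0)
    (hj : j ∉ ({j₀ - 1, j₀, j₀ + 1} : Finset ℤ)) : dyadicSymbol j ξ = 0 := by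
  by_contra hne
  have h1 := le_add_one_of_dyadicSymbol_ne_zero hj₀ hne
  have h2 := le_add_one_of_dyadicSymbol_ne_zero hne hj₀
  apply hj
  simp only [Finset.mem_insert, Finset.mem_singleton]
  omega

/-- The two outer candidates `j₀ - 1`, `j₀ + 1` are not both in the support (they differ by `2`).
[folklore] -/
theorem dyadicSymbol_pred_eq_zero_or_succ_eq_zero (j₀ : ℤ) (ξ : E) :
    dyadicSymbol (j₀ - 1) ξ = 0 ∨ dyadicSymbol (j₀ + 1) ξ = 0 := by
  by_contra h
  push Not at h
  have := le_add_one_of_dyadicSymbol_ne_zero h.1 h.2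
  omega

/-- **The squares of the dyadic symbols sum to at most `8`**: at most two symbols are nonzero at
each `ξ`, each of modulus `≤ 2`. [folklore] -/
theorem tsum_enorm_dyadicSymbol_sq_le (ξ : E) :
    ∑' j : ℤ, ‖dyadicSymbol j ξ‖ₑ ^ 2 ≤ 8 := by
  classical
  by_cases hex : ∃ j₀ : ℤ, dyadicSymbol j₀ ξ ≠ 0
  · obtain ⟨j₀, hj₀⟩ := hex
    rw [tsum_eq_sum (s := ({j₀ - 1, j₀, j₀ + 1} : Finset ℤ)) (fun j hj => by
      simp [dyadicSymbol_eq_zero_of_not_mem hj₀ hj])]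
    have hj01 : j₀ - 1 ≠ j₀ := by omega
    have hj02 : j₀ - 1 ≠ j₀ + 1 := by omega
    have hj03 : j₀ ≠ j₀ + 1 := by omega
    rw [Finset.sum_insert (by simp [hj01, hj02]), Finset.sum_insert (by simp [hj03]),
      Finset.sum_singleton]
    have h4 := enorm_dyadicSymbol_sq_le_four (E := E)
    rcases dyadicSymbol_pred_eq_zero_or_succ_eq_zero j₀ ξ with ha | hb
    · rw [ha, enorm_zero, zero_pow two_ne_zero, zero_add]
      calc ‖dyadicSymbol j₀ ξ‖ₑ ^ 2 + ‖dyadicSymbol (j₀ + 1) ξ‖ₑ ^ 2 ≤ 4 + 4 := add_le_add (h4 _ _) (h4 _ _)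
        _ = 8 := by norm_num
    · rw [hb, enorm_zero, zero_pow two_ne_zero, add_zero]
      calc ‖dyadicSymbol (j₀ - 1) ξ‖ₑ ^ 2 + ‖dyadicSymbol j₀ ξ‖ₑ ^ 2 ≤ 4 + 4 := add_le_add (h4 _ _) (h4 _ _)
        _ = 8 := by norm_num
  · push Not at hex
    simp [hex]

/-- **The squares of the dyadic symbols sum to at least `1/2`** off the origin: `∑_j φ_j(ξ) = 1`
(BCD Prop. 2.10) with at most two nonzero terms, and `|a|² + |b|² ≥ |a + b|²/2`. [folklore] -/
theorem half_le_tsum_enorm_dyadicSymbol_sq {ξ : E} (hξ : ξ ≠ 0) :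
    2⁻¹ ≤ ∑' j : ℤ, ‖dyadicSymbol j ξ‖ₑ ^ 2 := by
  classical
  have hsum : HasSum (fun j : ℤ => dyadicSymbol j ξ) 1 := sum_dyadicSymbol_holds hξ
  obtain ⟨j₀, hj₀⟩ : ∃ j₀ : ℤ, dyadicSymbol j₀ ξ ≠ 0 := by
    by_contra h
    push Not at h
    have h0 : HasSum (fun j : ℤ => dyadicSymbol j ξ) 0 := by simp [h, hasSum_zero]
    exact one_ne_zero (hsum.unique h0)
  set S : Finset ℤ := {j₀ - 1, j₀, j₀ + 1} with hS
  have hfin : ∑ j ∈ S, dyadicSymbol j ξ = 1 :=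
    (hsum.unique (hasSum_sum_of_ne_finset_zero fun j hj => dyadicSymbol_eq_zero_of_not_mem hj₀ hj)).symm
  have hj01 : j₀ - 1 ≠ j₀ := by omega
  have hj02 : j₀ - 1 ≠ j₀ + 1 := by omega
  have hj03 : j₀ ≠ j₀ + 1 := by omega
  rw [hS, Finset.sum_insert (by simp [hj01, hj02]), Finset.sum_insert (by simp [hj03]),
    Finset.sum_singleton] at hfin
  -- two complex numbers with `a + b = 1` have `1/2 ≤ |a|² + |b|²`
  have key : ∀ a b : ℂ, a + b = 1 → (2⁻¹ : ℝ≥0∞) ≤ ‖a‖ₑ ^ 2 + ‖b‖ₑ ^ 2 := by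
    intro a b hab
    have hr : (2⁻¹ : ℝ) ≤ ‖a‖ ^ 2 + ‖b‖ ^ 2 := by
      have h1 : (1 : ℝ) ≤ ‖a‖ + ‖b‖ := by
        calc (1 : ℝ) = ‖a + b‖ := by rw [hab, norm_one]
          _ ≤ ‖a‖ + ‖b‖ := norm_add_le a b
      nlinarith [sq_nonneg (‖a‖ - ‖b‖), norm_nonneg a, norm_nonneg b]
    calc (2⁻¹ : ℝ≥0∞) = ENNReal.ofReal (2⁻¹ : ℝ) := by
          rw [ENNReal.ofReal_inv_of_pos two_pos, ENNReal.ofReal_ofNat]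
      _ ≤ ENNReal.ofReal (‖a‖ ^ 2 + ‖b‖ ^ 2) := ENNReal.ofReal_le_ofReal hr
      _ = ‖a‖ₑ ^ 2 + ‖b‖ₑ ^ 2 := by
          rw [ENNReal.ofReal_add (sq_nonneg _) (sq_nonneg _), ENNReal.ofReal_pow (norm_nonneg _),
            ENNReal.ofReal_pow (norm_nonneg _), ofReal_norm, ofReal_norm]
  refine le_trans ?_ (ENNReal.sum_le_tsum S)
  rw [hS, Finset.sum_insert (by simp [hj01, hj02]), Finset.sum_insert (by simp [hj03]),
    Finset.sum_singleton]
  rcases dyadicSymbol_pred_eq_zero_or_succ_eq_zero j₀ ξ with ha | hb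
  · rw [ha, zero_add] at hfin
    rw [ha, enorm_zero, zero_pow two_ne_zero, zero_add]
    exact key _ _ hfin
  · rw [hb, add_zero] at hfin
    rw [hb, enorm_zero, zero_pow two_ne_zero, add_zero]
    calc (2⁻¹ : ℝ≥0∞) ≤ ‖dyadicSymbol (j₀ - 1) ξ‖ₑ ^ 2 + ‖dyadicSymbol j₀ ξ‖ₑ ^ 2 := key _ _ hfin
      _ = _ := rfl

/-- The squared dyadic symbols are measurable in `ξ`. [folklore] -/
theorem measurable_tsum_enorm_dyadicSymbol_sq [MeasurableSpace E] [BorelSpace E] :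
    Measurable fun ξ : E => ∑' j : ℤ, ‖dyadicSymbol j ξ‖ₑ ^ 2 :=
  Measurable.tsum fun j => ((contDiff_dyadicSymbol j).continuous.measurable.enorm.pow_const 2)

end Symbol


/-! ## Plancherel for Fourier multipliers on `L²` -/

section Plancherel

variable {E : Type*} [NormedAddCommGroup E] [InnerProductSpace ℝ E] [FiniteDimensional ℝ E]
  [MeasurableSpace E] [BorelSpace E]
variable {F : Type*} [NormedAddCommGroup F] [InnerProductSpace ℂ F] [CompleteSpace F]

/-- A continuous bounded symbol is an `L^∞` function. [folklore] -/
theorem memLp_top_of_norm_le {m : E → ℂ} (hm : Continuous m) {M : ℝ} (hM : ∀ ξ, ‖m ξ‖ ≤ M) :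
    MemLp m ∞ (volume : Measure E) :=
  memLp_top_of_bound hm.aestronglyMeasurable M (ae_of_all _ hM)

/-- **Fourier multipliers act on `L²` through the `L²` Fourier transform**: for a bounded symbol
`m` of temperate growth and `f ∈ L²`, `m(D) f = 𝓕⁻¹ (m · 𝓕 f)` with Mathlib's `L²` Fourier
isometry (`MeasureTheory.Lp.fourierTransformₗᵢ`) and the `L^∞ · L²` product in `L²`. [folklore] -/
theorem fourierMultiplierCLM_coe_eq_coe {m : E → ℂ} (hm : m.HasTemperateGrowth)
    (hm' : MemLp m ∞ (volume : Measure E)) (f : Lp F 2 (volume : Measure E)) :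
    fourierMultiplierCLM F m (f : 𝓢'(E, F)) =
      (((𝓕⁻ ((hm'.toLp m) • (𝓕 f : Lp F 2 (volume : Measure E))) : Lp F 2 (volume : Measure E))) :
        𝓢'(E, F)) := by
  rw [TemperedDistribution.fourierMultiplierCLM_apply, Lp.fourier_toTemperedDistribution_eq,
    ← Lp.toTemperedDistribution_smul_eq (r := 2) hm hm', Lp.fourierInv_toTemperedDistribution_eq]

omit [InnerProductSpace ℂ F] [CompleteSpace F] in
/-- The squared `L²` norm of an `L²` function as a lower Lebesgue integral. [folklore] -/
theorem enorm_Lp_two_sq (g : Lp F 2 (volume : Measure E)) :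
    ‖g‖ₑ ^ 2 = ∫⁻ x, ‖(g : E → F) x‖ₑ ^ 2 := by
  rw [Lp.enorm_def, eLpNorm_eq_lintegral_rpow_enorm_toReal two_ne_zero ENNReal.ofNat_ne_top,
    ENNReal.toReal_ofNat, ← ENNReal.rpow_natCast, ← ENNReal.rpow_mul]
  norm_num

/-- **Plancherel for a multiplier**: `‖m(D) f‖²_{L²} = ∫ |m(ξ)|² ‖𝓕f(ξ)‖² dξ`. [folklore] -/
theorem enorm_fourierInv_smul_fourier_sq {m : E → ℂ} (hm' : MemLp m ∞ (volume : Measure E))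
    (f : Lp F 2 (volume : Measure E)) :
    ‖(𝓕⁻ ((hm'.toLp m) • (𝓕 f : Lp F 2 (volume : Measure E))) : Lp F 2 (volume : Measure E))‖ₑ ^ 2 =
      ∫⁻ ξ, ‖m ξ‖ₑ ^ 2 * ‖((𝓕 f : Lp F 2 (volume : Measure E)) : E → F) ξ‖ₑ ^ 2 := by
  have hiso : ‖(𝓕⁻ ((hm'.toLp m) • (𝓕 f : Lp F 2 (volume : Measure E))) : Lp F 2 (volume : Measure E))‖ₑ =
      ‖(hm'.toLp m) • (𝓕 f : Lp F 2 (volume : Measure E))‖ₑ := by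
    rw [← ofReal_norm, ← ofReal_norm]
    congr 1
    exact (Lp.fourierTransformₗᵢ E F).symm.norm_map _
  rw [hiso, enorm_Lp_two_sq]
  refine lintegral_congr_ae ?_
  filter_upwards [Lp.coeFn_lpSMul (r := 2) (hm'.toLp m) (𝓕 f : Lp F 2 (volume : Measure E)),
    hm'.coeFn_toLp] with ξ h1 h2
  rw [h1, Pi.smul_apply', h2, enorm_smul, mul_pow]

/-- **The `L²` norm of a Fourier multiplier with bounded symbol, distributionally**:
`(eLpNormDistrib 2 (m(D) f))² = ∫ |m|² ‖𝓕f‖²` for `f ∈ L²`. [folklore] -/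
theorem eLpNormDistrib_fourierMultiplierCLM_coe_sq {m : E → ℂ} (hm : m.HasTemperateGrowth)
    (hm' : MemLp m ∞ (volume : Measure E)) (f : Lp F 2 (volume : Measure E)) :
    eLpNormDistrib 2 (fourierMultiplierCLM F m (f : 𝓢'(E, F))) ^ 2 =
      ∫⁻ ξ, ‖m ξ‖ₑ ^ 2 * ‖((𝓕 f : Lp F 2 (volume : Measure E)) : E → F) ξ‖ₑ ^ 2 := by
  rw [fourierMultiplierCLM_coe_eq_coe hm hm', eLpNormDistrib_coe, enorm_fourierInv_smul_fourier_sq]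

/-- `‖𝓕 f‖²_{L²} = ‖f‖²_{L²}` as a lower integral (Plancherel). [folklore] -/
theorem lintegral_enorm_fourier_sq (f : Lp F 2 (volume : Measure E)) :
    ∫⁻ ξ, ‖((𝓕 f : Lp F 2 (volume : Measure E)) : E → F) ξ‖ₑ ^ 2 = ‖f‖ₑ ^ 2 := by
  rw [← enorm_Lp_two_sq, ← ofReal_norm, ← ofReal_norm, Lp.norm_fourier_eq]

/-! ## The square function theorem for `Ḃ⁰_{2,2} = L²` -/

/-- The dyadic symbol is an `L^∞` function. [folklore] -/
theorem memLp_top_dyadicSymbol (j : ℤ) : MemLp (dyadicSymbol (E := E) j) ∞ (volume : Measure E) :=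
  memLp_top_of_norm_le (contDiff_dyadicSymbol j).continuous (norm_dyadicSymbol_le_two j)

/-- **Upper square function bound** (BCD §2.2: the blocks are almost orthogonal in `L²`):
`∑_j ‖Δ̇_j f‖²_{L²} ≤ 8 ‖f‖²_{L²}` for `f ∈ L²`, since `∑_j |φ_j|² ≤ 8` pointwise. [folklore] -/
theorem tsum_eLpNormDistrib_lpBlock_sq_le (f : Lp F 2 (volume : Measure E)) :
    ∑' j : ℤ, eLpNormDistrib 2 (lpBlock j (f : 𝓢'(E, F))) ^ 2 ≤ 8 * ‖f‖ₑ ^ 2 := by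
  have hrep : ∀ j : ℤ, eLpNormDistrib 2 (lpBlock j (f : 𝓢'(E, F))) ^ 2 =
      ∫⁻ ξ, ‖dyadicSymbol j ξ‖ₑ ^ 2 * ‖((𝓕 f : Lp F 2 (volume : Measure E)) : E → F) ξ‖ₑ ^ 2 := fun j =>
    eLpNormDistrib_fourierMultiplierCLM_coe_sq (hasTemperateGrowth_dyadicSymbol j)
      (memLp_top_dyadicSymbol j) f
  simp_rw [hrep]
  have hmeas : ∀ j : ℤ, AEMeasurable (fun ξ => ‖dyadicSymbol (E := E) j ξ‖ₑ ^ 2 *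
      ‖((𝓕 f : Lp F 2 (volume : Measure E)) : E → F) ξ‖ₑ ^ 2) volume := fun j =>
    (((contDiff_dyadicSymbol j).continuous.measurable.enorm.pow_const 2).aemeasurable.mul
      ((Lp.aestronglyMeasurable _).enorm.pow_const 2))
  rw [← lintegral_tsum hmeas, ← lintegral_enorm_fourier_sq, ← lintegral_const_mul' _ _ (by norm_num)]
  refine lintegral_mono fun ξ => ?_
  rw [ENNReal.tsum_mul_right]
  exact mul_le_mul_left (tsum_enorm_dyadicSymbol_sq_le ξ) _

/-- **Lower square function bound**: `‖f‖²_{L²} ≤ 2 ∑_j ‖Δ̇_j f‖²_{L²}` for `f ∈ L²`, since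
`∑_j |φ_j|² ≥ 1/2` off the origin (a null set). [folklore] -/
theorem enorm_sq_le_two_mul_tsum_eLpNormDistrib_lpBlock_sq [Nontrivial E] (f : Lp F 2 (volume : Measure E)) :
    ‖f‖ₑ ^ 2 ≤ 2 * ∑' j : ℤ, eLpNormDistrib 2 (lpBlock j (f : 𝓢'(E, F))) ^ 2 := by
  have hrep : ∀ j : ℤ, eLpNormDistrib 2 (lpBlock j (f : 𝓢'(E, F))) ^ 2 =
      ∫⁻ ξ, ‖dyadicSymbol j ξ‖ₑ ^ 2 * ‖((𝓕 f : Lp F 2 (volume : Measure E)) : E → F) ξ‖ₑ ^ 2 := fun j =>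
    eLpNormDistrib_fourierMultiplierCLM_coe_sq (hasTemperateGrowth_dyadicSymbol j)
      (memLp_top_dyadicSymbol j) f
  simp_rw [hrep]
  have hmeas : ∀ j : ℤ, AEMeasurable (fun ξ => ‖dyadicSymbol (E := E) j ξ‖ₑ ^ 2 *
      ‖((𝓕 f : Lp F 2 (volume : Measure E)) : E → F) ξ‖ₑ ^ 2) volume := fun j =>
    (((contDiff_dyadicSymbol j).continuous.measurable.enorm.pow_const 2).aemeasurable.mul
      ((Lp.aestronglyMeasurable _).enorm.pow_const 2))
  rw [← lintegral_tsum hmeas, ← lintegral_enorm_fourier_sq, ← lintegral_const_mul' _ _ (by norm_num)]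
  -- off the origin `1 ≤ 2 ∑_j |φ_j|²`
  have hae : ∀ᵐ ξ : E ∂volume, ξ ≠ 0 := by
    have : (volume : Measure E) {0} = 0 := measure_singleton 0
    filter_upwards [measure_eq_zero_iff_ae_notMem.1 this] with ξ hξ
    simpa using hξ
  refine lintegral_mono_ae ?_
  filter_upwards [hae] with ξ hξ
  rw [ENNReal.tsum_mul_right, ← mul_assoc]
  calc ‖((𝓕 f : Lp F 2 (volume : Measure E)) : E → F) ξ‖ₑ ^ 2
      = 1 * ‖((𝓕 f : Lp F 2 (volume : Measure E)) : E → F) ξ‖ₑ ^ 2 := (one_mul _).symm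
    _ ≤ (2 * ∑' j : ℤ, ‖dyadicSymbol j ξ‖ₑ ^ 2) * ‖((𝓕 f : Lp F 2 (volume : Measure E)) : E → F) ξ‖ₑ ^ 2 := by
        gcongr
        calc (1 : ℝ≥0∞) = 2 * 2⁻¹ := by rw [ENNReal.mul_inv_cancel two_ne_zero ENNReal.ofNat_ne_top]
          _ ≤ 2 * ∑' j : ℤ, ‖dyadicSymbol j ξ‖ₑ ^ 2 := by
              gcongr
              exact half_le_tsum_enorm_dyadicSymbol_sq hξ

/-! ## Convergence of the symmetric partial sums `∑_{|j| ≤ n} Δ̇_j f → f` in `L²` -/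

/-- The symbol `r_n = 1 - (χ(2^{-n}·) - χ(2^{n+1}·))` of `Id - ∑_{|j| ≤ n} Δ̇_j = Id - (Ṡ_n - Ṡ_{-n-1})`.
[folklore] -/
def remainderSymbol (n : ℕ) (ξ : E) : ℂ :=
  1 - (lowFreqSymbol (n : ℤ) ξ - lowFreqSymbol (-(n : ℤ) - 1) ξ)

omit [FiniteDimensional ℝ E] [MeasurableSpace E] [BorelSpace E] in
/-- `‖r_n(ξ)‖ ≤ 3`. [folklore] -/
theorem norm_remainderSymbol_le (n : ℕ) (ξ : E) : ‖remainderSymbol n ξ‖ ≤ 3 := by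
  unfold remainderSymbol
  have h1 := norm_lowFreqSymbol_le_one (E := E) (n : ℤ) ξ
  have h2 := norm_lowFreqSymbol_le_one (E := E) (-(n : ℤ) - 1) ξ
  calc ‖1 - (lowFreqSymbol (n : ℤ) ξ - lowFreqSymbol (-(n : ℤ) - 1) ξ)‖
      ≤ ‖(1 : ℂ)‖ + ‖lowFreqSymbol (n : ℤ) ξ - lowFreqSymbol (-(n : ℤ) - 1) ξ‖ := norm_sub_le _ _
    _ ≤ ‖(1 : ℂ)‖ + (‖lowFreqSymbol (n : ℤ) ξ‖ + ‖lowFreqSymbol (-(n : ℤ) - 1) ξ‖) := by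
        gcongr; exact norm_sub_le _ _
    _ ≤ 1 + (1 + 1) := by rw [norm_one]; gcongr
    _ = 3 := by norm_num

omit [FiniteDimensional ℝ E] [MeasurableSpace E] [BorelSpace E] in
/-- `‖r_n(ξ)‖ₑ² ≤ 9`. [folklore] -/
theorem enorm_remainderSymbol_sq_le (n : ℕ) (ξ : E) : ‖remainderSymbol n ξ‖ₑ ^ 2 ≤ 9 := by
  have h : ‖remainderSymbol n ξ‖ₑ ≤ 3 := by
    rw [← ofReal_norm]
    exact (ENNReal.ofReal_le_ofReal (norm_remainderSymbol_le n ξ)).trans_eq (by simp)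
  calc ‖remainderSymbol n ξ‖ₑ ^ 2 ≤ 3 ^ 2 := pow_le_pow_left' h 2
    _ = 9 := by norm_num

omit [MeasurableSpace E] [BorelSpace E] in
/-- `r_n` has temperate growth. [folklore] -/
theorem hasTemperateGrowth_remainderSymbol (n : ℕ) : (remainderSymbol (E := E) n).HasTemperateGrowth :=
  (Function.HasTemperateGrowth.const 1).sub
    ((hasTemperateGrowth_lowFreqSymbol _).sub (hasTemperateGrowth_lowFreqSymbol _))

omit [FiniteDimensional ℝ E] [MeasurableSpace E] [BorelSpace E] in
/-- `r_n` is continuous. [folklore] -/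
theorem continuous_remainderSymbol (n : ℕ) : Continuous (remainderSymbol (E := E) n) :=
  continuous_const.sub
    ((contDiff_lowFreqSymbol _).continuous.sub (contDiff_lowFreqSymbol _).continuous)

omit [FiniteDimensional ℝ E] [MeasurableSpace E] [BorelSpace E] in
/-- The far low-frequency cut-off eventually vanishes off the origin: `χ(2^{n+1} ξ) = 0` once
`2 ≤ 2^{n+1} ‖ξ‖`. [folklore] -/
theorem eventually_lowFreqSymbol_neg_eq_zero {ξ : E} (hξ : ξ ≠ 0) :
    ∀ᶠ n : ℕ in atTop, lowFreqSymbol (E := E) (-(n : ℤ) - 1) ξ = 0 := by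
  have hpos : 0 < ‖ξ‖ := norm_pos_iff.2 hξ
  obtain ⟨N, hN⟩ := exists_nat_gt (2 / ‖ξ‖)
  refine eventually_atTop.2 ⟨N, fun n hn => ?_⟩
  simp only [lowFreqSymbol]
  rw [dyadicCutoff_apply_of_two_le_norm, Complex.ofReal_zero]
  rw [norm_smul, Real.norm_of_nonneg (zpow_nonneg zero_le_two _), neg_sub, sub_neg_eq_add]
  have h2n : (n : ℝ) + 1 ≤ (2 : ℝ) ^ ((1 : ℤ) + (n : ℤ)) := by
    rw [show ((1 : ℤ) + (n : ℤ)) = ((n + 1 : ℕ) : ℤ) by push_cast; ring, zpow_natCast]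
    exact_mod_cast (Nat.lt_two_pow_self (n := n + 1)).le
  have hN' : 2 / ‖ξ‖ ≤ (n : ℝ) + 1 := by linarith [hN, (Nat.cast_le.2 hn : (N : ℝ) ≤ n)]
  have : 2 / ‖ξ‖ ≤ (2 : ℝ) ^ ((1 : ℤ) + (n : ℤ)) := hN'.trans h2n
  rwa [div_le_iff₀ hpos] at this

omit [FiniteDimensional ℝ E] [MeasurableSpace E] [BorelSpace E] in
/-- **`r_n(ξ) → 0` off the origin**: `χ(2^{-n}ξ) → 1` and `χ(2^{n+1}ξ) = 0` for `n` large. [folklore] -/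
theorem tendsto_remainderSymbol {ξ : E} (hξ : ξ ≠ 0) :
    Tendsto (fun n : ℕ => remainderSymbol n ξ) atTop (𝓝 0) := by
  have h1 : Tendsto (fun n : ℕ => lowFreqSymbol (E := E) (n : ℤ) ξ) atTop (𝓝 1) :=
    (tendsto_lowFreqSymbol_atTop ξ).comp tendsto_natCast_atTop_atTop
  have h3 : Tendsto (fun n : ℕ => lowFreqSymbol (E := E) (-(n : ℤ) - 1) ξ) atTop (𝓝 0) :=
    tendsto_const_nhds.congr' ((eventually_lowFreqSymbol_neg_eq_zero hξ).mono fun n hn => hn.symm)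
  have := (tendsto_const_nhds (x := (1 : ℂ))).sub (h1.sub h3)
  simpa [remainderSymbol] using this

omit [CompleteSpace F] in
/-- **`Id - ∑_{|j| ≤ n} Δ̇_j` is the multiplier `r_n(D)`** on `𝓢'` (`∑_{|j|≤n} Δ̇_j = Ṡ_n - Ṡ_{-n-1}`,
`Literature.Analysis.FunctionSpaces.sum_Icc_lpBlock_eq`). [folklore] -/
theorem sub_sum_lpBlock_eq_fourierMultiplierCLM (u : 𝓢'(E, F)) (n : ℕ) :
    u - ∑ j ∈ Finset.Icc (-(n : ℤ)) n, lpBlock j u = fourierMultiplierCLM F (remainderSymbol n) u := by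
  have h1 : (remainderSymbol (E := E) n) =
      (fun _ : E => (1 : ℂ)) - (lowFreqSymbol (n : ℤ) - lowFreqSymbol (-(n : ℤ) - 1)) := by
    funext ξ; simp [remainderSymbol]
  rw [sum_Icc_lpBlock_eq, h1,
    fourierMultiplierCLM_sub (Function.HasTemperateGrowth.const 1)
      ((hasTemperateGrowth_lowFreqSymbol _).sub (hasTemperateGrowth_lowFreqSymbol _)),
    fourierMultiplierCLM_sub (hasTemperateGrowth_lowFreqSymbol _) (hasTemperateGrowth_lowFreqSymbol _),
    TemperedDistribution.fourierMultiplierCLM_const]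
  simp only [sub_apply, ContinuousLinearMap.id_apply, one_smul, lowFreqCutoff_apply]

/-- **The symmetric partial sums of the Littlewood–Paley decomposition converge in `L²`**:
`‖f - ∑_{|j| ≤ n} Δ̇_j f‖_{L²} → 0` for `f ∈ L²` (Plancherel and dominated convergence:
`∫ |r_n|² ‖𝓕f‖² → 0`; BCD Prop. 2.14 for `L^p`, here the elementary `L²` case). [folklore] -/
theorem tendsto_eLpNormDistrib_sub_sum_lpBlock [Nontrivial E] (f : Lp F 2 (volume : Measure E)) :
    Tendsto (fun n : ℕ => eLpNormDistrib 2 ((f : 𝓢'(E, F)) - ∑ j ∈ Finset.Icc (-(n : ℤ)) n,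
      lpBlock j (f : 𝓢'(E, F)))) atTop (𝓝 0) := by
  set g : E → ℝ≥0∞ := fun ξ => ‖((𝓕 f : Lp F 2 (volume : Measure E)) : E → F) ξ‖ₑ ^ 2 with hg
  have hmem : ∀ n : ℕ, MemLp (remainderSymbol (E := E) n) ∞ (volume : Measure E) := fun n =>
    memLp_top_of_norm_le (continuous_remainderSymbol n) (norm_remainderSymbol_le n)
  -- the squares converge to `0` by dominated convergence
  have hsq : Tendsto (fun n : ℕ => eLpNormDistrib 2 ((f : 𝓢'(E, F)) - ∑ j ∈ Finset.Icc (-(n : ℤ)) n,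
      lpBlock j (f : 𝓢'(E, F))) ^ 2) atTop (𝓝 0) := by
    have hrep : ∀ n : ℕ, eLpNormDistrib 2 ((f : 𝓢'(E, F)) - ∑ j ∈ Finset.Icc (-(n : ℤ)) n,
        lpBlock j (f : 𝓢'(E, F))) ^ 2 = ∫⁻ ξ, ‖remainderSymbol n ξ‖ₑ ^ 2 * g ξ := fun n => by
      rw [sub_sum_lpBlock_eq_fourierMultiplierCLM,
        eLpNormDistrib_fourierMultiplierCLM_coe_sq (hasTemperateGrowth_remainderSymbol n) (hmem n)]
    simp_rw [hrep]
    have hlim : ∫⁻ ξ : E, (0 : ℝ≥0∞) * g ξ = 0 := by simp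
    rw [← hlim]
    refine tendsto_lintegral_of_dominated_convergence' (fun ξ => 9 * g ξ) (fun n => ?_) (fun n => ?_)
      ?_ ?_
    · exact (((continuous_remainderSymbol n).measurable.enorm.pow_const 2).aemeasurable.mul
        ((Lp.aestronglyMeasurable _).enorm.pow_const 2))
    · exact ae_of_all _ fun ξ => mul_le_mul_left (enorm_remainderSymbol_sq_le n ξ) _
    · rw [lintegral_const_mul' _ _ (by norm_num), hg, lintegral_enorm_fourier_sq]
      exact ENNReal.mul_ne_top (by norm_num) (ENNReal.pow_ne_top enorm_ne_top)
    · have hae : ∀ᵐ ξ : E ∂volume, ξ ≠ 0 := by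
        have : (volume : Measure E) {0} = 0 := measure_singleton 0
        filter_upwards [measure_eq_zero_iff_ae_notMem.1 this] with ξ hξ
        simpa using hξ
      filter_upwards [hae] with ξ hξ
      have h0 : Tendsto (fun n : ℕ => ‖remainderSymbol n ξ‖ₑ ^ 2) atTop (𝓝 0) := by
        have h := ((tendsto_remainderSymbol hξ).enorm).ennrpow_const (2 : ℝ)
        simp only [enorm_zero, ENNReal.zero_rpow_of_pos two_pos, ENNReal.rpow_two] at h
        exact h
      exact ENNReal.Tendsto.mul_const h0 (Or.inr (ENNReal.pow_ne_top enorm_ne_top))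
  -- take square roots
  have h := hsq.ennrpow_const (2⁻¹ : ℝ)
  rw [ENNReal.zero_rpow_of_pos (by norm_num : (0 : ℝ) < 2⁻¹)] at h
  refine h.congr fun n => ?_
  rw [← ENNReal.rpow_natCast, ← ENNReal.rpow_mul]
  norm_num

end Plancherel

end Literature.Analysis.FunctionSpaces

end
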